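import Literature.NumberTheory.EllipticCurves.HeckeEisensteinWeightOneCusps
import Literature.NumberTheory.EllipticCurves.EisensteinSeriesTwoCharacterWeightTwoCusps
import Literature.NumberTheory.LFunctions.OddCharLogDerivFE
import HarnessLib

/-!
# The normalised weight-one Eisenstein series: `L(1, χ)`, integrality, and the cusp unit

Topic `Literature/NumberTheory/EllipticCurves`; namespace
`Literature.NumberTheory.EllipticCurves.ModularForms`.  Definitions with bodies
(`heckeOneConst`, `heckeOneUnit`) and theorems; no named fact.

Dividing Hecke's weight-one Eisenstein series `G̃_χ(·,0)` (`χ` odd primitive modulo `M > 1`,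
`HeckeEisensteinWeightOneForm`) by its coefficient constant `c₁ = -4πiτ(χ)/M` gives a form with
`q`-expansion `-B_{1,χ̄}/2 + ∑_{n ≥ 1} σ^{χ̄}(n) qⁿ`:

* `LFunction_one_eq_of_odd` — `L(1, χ) = π τ(χ) L(0, χ̄)/(iM)` (functional equation at `s = 0`,
  Mathlib `completedLFunction_one_sub`, `Γ_ℝ(1) = 1`, `Γ_ℝ(2) = 1/π` from `OddCharLogDerivFE`), so the constant
  coefficient is `c₁⁻¹ · 2L(1,χ) = L(0, χ̄)/2 = -B_{1,χ̄}/2`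
  (`inv_heckeOneConst_mul_heckeOneCoeff_zero`);
* `inv_heckeOneConst_mul_heckeOneCusp_of_isUnit` — at a cusp `A∞` with `c_A` prime to `M` the
  normalised constant term is `heckeOneUnit χ · χ̄(c_A)` with `heckeOneUnit χ = -B_{1,χ}/(2τ(χ))`;
* `p`-adic valuations (`ι : ℚ̄_p ≃ ℂ`, `p ∤ 2M`): the normalised coefficients are integral
  (`valuation_inv_heckeOneConst_mul_coeff_le_one`) and `heckeOneUnit χ` is a unit as soon as
  `B_{1,χ}` is (`valuation_heckeOneUnit_eq_one`).

## References

* E. Hecke, *Theorie der Eisensteinschen Reihen höherer Stufe…*, Abh. Math. Sem. Hamburg 5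
  (1927), §2. [Hecke1927]
* T. Miyake, *Modular Forms*, Springer (2006), Thm. 7.2.13, Thm. 3.3.4 (`L(1,χ)`). [Miyake2006]
* L. C. Washington, *Introduction to Cyclotomic Fields*, GTM 83 (1997), Thm. 4.2. [Washington1997]
-/

noncomputable section

open Complex Filter Finset DirichletCharacter Literature.NumberTheory.LFunctions
open scoped Real Topology MatrixGroups

namespace Literature.NumberTheory.EllipticCurves.ModularForms

section LOne

variable {M : ℕ} [NeZero M] (χ : DirichletCharacter ℂ M)

omit [NeZero M] in
/-- `χ⁻¹` is odd when `χ` is. [folklore] -/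
theorem odd_inv (hodd : χ.Odd) : χ⁻¹.Odd := by
  change χ⁻¹ (-1) = -1
  rw [inv_apply_neg_one]; exact hodd

/-- **`L(1, χ) = π τ(χ) L(0, χ̄) / (iM)`** for an odd primitive character modulo `M > 1`
(functional equation at `s = 0`). [cite: Miyake2006, Thm. 3.3.4] [cite: Washington1997, Thm. 4.2] -/
theorem LFunction_one_eq_of_odd (hprim : χ.IsPrimitive) (hodd : χ.Odd) :
    χ.LFunction 1 = π * gaussSum χ (ZMod.stdAddChar (N := M)) * χ⁻¹.LFunction 0 /
      (Complex.I * M) := by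
  have hχ := ne_one_of_odd χ hodd
  have hM1 : M ≠ 1 := by rintro rfl; exact hχ (level_one χ)
  have hM0 : (M : ℂ) ≠ 0 := by exact_mod_cast NeZero.ne M
  have hπ : (π : ℂ) ≠ 0 := by exact_mod_cast Real.pi_ne_zero
  have h1 := LFunction_eq_completed_div_gammaFactor χ 1 (Or.inl one_ne_zero)
  rw [hodd.gammaFactor_def, show (1 : ℂ) + 1 = 2 by norm_num, OddCharLogDeriv.Gammaℝ_two] at h1
  have h2 := IsPrimitive.completedLFunction_one_sub hprim 0
  rw [sub_zero, zero_sub] at h2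
  have h3 := LFunction_eq_completed_div_gammaFactor χ⁻¹ 0 (Or.inr hM1)
  rw [(odd_inv χ hodd).gammaFactor_def, zero_add, Gammaℝ_one, div_one] at h3
  have hroot : rootNumber χ = gaussSum χ (ZMod.stdAddChar (N := M)) / Complex.I /
      (M : ℂ) ^ (1 / 2 : ℂ) := by
    rw [rootNumber, if_neg hodd.not_even, pow_one]
  have hpow : (M : ℂ) ^ (-(1 / 2 : ℂ)) / (M : ℂ) ^ (1 / 2 : ℂ) = (M : ℂ)⁻¹ := by
    rw [div_eq_mul_inv, ← cpow_neg, ← cpow_add _ _ hM0, show (-(1 / 2 : ℂ)) + -(1 / 2) = -1 by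
      norm_num, cpow_neg_one]
  rw [h1, h2, ← h3, hroot]
  have hhalf : (M : ℂ) ^ (1 / 2 : ℂ) ≠ 0 := (cpow_ne_zero_iff_of_exponent_ne_zero (by norm_num)).mpr hM0
  field_simp
  rw [show (M : ℂ) ^ (-(1 / 2 : ℂ)) = (M : ℂ)⁻¹ * (M : ℂ) ^ (1 / 2 : ℂ) by
    rw [← hpow]; field_simp]
  field_simp

end LOne

/-! ### The normalised form -/

section Normalised

variable {M : ℕ} [NeZero M] (χ : DirichletCharacter ℂ M)

/-- The coefficient constant `c₁ = -4πiτ(χ)/M` of `G̃_χ(·,0)`. [cite: Miyake2006, Thm. 7.2.13] -/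
def heckeOneConst : ℂ := -(4 * π * Complex.I * gaussSum χ (ZMod.stdAddChar (N := M)) / M)

/-- `c₁ ≠ 0` (`χ` primitive). [folklore] -/
theorem heckeOneConst_ne_zero (hprim : χ.IsPrimitive) : heckeOneConst χ ≠ 0 := by
  have hW := gaussSum_ne_zero χ hprim
  have hM0 : (M : ℂ) ≠ 0 := by exact_mod_cast NeZero.ne M
  have hπ : (π : ℂ) ≠ 0 := by exact_mod_cast Real.pi_ne_zero
  rw [heckeOneConst, neg_ne_zero]
  exact div_ne_zero (mul_ne_zero (mul_ne_zero (mul_ne_zero (by norm_num) hπ) I_ne_zero) hW) hM0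

/-- The higher coefficients: `aₙ = c₁ σ^{χ̄}(n)` for `n ≥ 1`. [cite: Miyake2006, Thm. 7.2.13] -/
theorem heckeOneCoeff_of_ne_zero {n : ℕ} (hn : n ≠ 0) :
    heckeOneCoeff χ n = heckeOneConst χ * ∑ d ∈ n.divisors, χ⁻¹ (d : ZMod M) := by
  rw [heckeOneCoeff, if_neg hn, heckeOneConst]

/-- **The normalised constant coefficient**: `c₁⁻¹ a₀ = c₁⁻¹ · 2L(1,χ) = -B_{1,χ̄}/2` (odd primitive
`χ`). [cite: Miyake2006, Thm. 7.2.13] [cite: Washington1997, Thm. 4.2] -/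
theorem inv_heckeOneConst_mul_heckeOneCoeff_zero (hprim : χ.IsPrimitive) (hodd : χ.Odd) :
    (heckeOneConst χ)⁻¹ * heckeOneCoeff χ 0 = -(generalizedBernoulli 1 χ⁻¹) / 2 := by
  have hW := gaussSum_ne_zero χ hprim
  have hM0 : (M : ℂ) ≠ 0 := by exact_mod_cast NeZero.ne M
  have hπ : (π : ℂ) ≠ 0 := by exact_mod_cast Real.pi_ne_zero
  rw [heckeOneCoeff, if_pos rfl, LFunction_one_eq_of_odd χ hprim hodd,
    LFunction_zero_eq_neg_generalizedBernoulli_one χ⁻¹ (odd_inv χ hodd), heckeOneConst]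
  field_simp
  ring_nf
  rw [Complex.I_sq]
  ring

/-- **The cusp unit `-B_{1,χ}/(2τ(χ))`** of the normalised weight-one Eisenstein series.
[cite: Hecke1927, §2] -/
def heckeOneUnit : ℂ := -(generalizedBernoulli 1 χ) / (2 * gaussSum χ (ZMod.stdAddChar (N := M)))

/-- **Normalised constant terms at the cusps prime to the level**:
`c₁⁻¹ · heckeOneCusp χ A = heckeOneUnit χ · χ̄(c_A)` for `c_A` a unit modulo `M`.
[cite: Hecke1927, §2] -/
theorem inv_heckeOneConst_mul_heckeOneCusp_of_isUnit (hprim : χ.IsPrimitive) (hodd : χ.Odd)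
    {A : SL(2, ℤ)} (hc : IsUnit ((A 1 0 : ℤ) : ZMod M)) :
    (heckeOneConst χ)⁻¹ * heckeOneCusp χ A = heckeOneUnit χ * χ⁻¹ ((A 1 0 : ℤ) : ZMod M) := by
  have hW := gaussSum_ne_zero χ hprim
  have hM0 : (M : ℂ) ≠ 0 := by exact_mod_cast NeZero.ne M
  have hπ : (π : ℂ) ≠ 0 := by exact_mod_cast Real.pi_ne_zero
  rw [heckeOneCusp_of_isUnit χ hodd hc, heckeOneConst, heckeOneUnit]
  field_simp
  ring_nf

/-! ### `p`-adic valuations -/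

variable {p : ℕ} [Fact p.Prime]

/-- Values of a Dirichlet character are `p`-adic integers. [folklore] -/
theorem valuation_symm_apply_le_one (ι : PadicAlgCl p ≃+* ℂ) (x : ZMod M) :
    Valued.v (ι.symm (χ x)) ≤ 1 := by
  by_cases hx : IsUnit x
  · obtain ⟨u, rfl⟩ := hx
    have h : (χ u) ^ Fintype.card (ZMod M)ˣ = 1 := by
      rw [← MulChar.coe_toUnitHom, ← Units.val_pow_eq_pow_val, ← map_pow, pow_card_eq_one, map_one,
        Units.val_one]
    have h2 : (Valued.v (ι.symm (χ u))) ^ Fintype.card (ZMod M)ˣ = 1 := by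
      rw [← Valuation.map_pow, ← map_pow, h, map_one, Valuation.map_one]
    exact ((pow_eq_one_iff_of_nonneg zero_le Fintype.card_ne_zero).mp h2).le
  · rw [MulChar.map_nonunit χ hx, map_zero, Valuation.map_zero]; exact zero_le

/-- **`B_{1,χ}` is `p`-integral** for `p ∤ M` and `χ ≠ 1` (`B_{1,χ} = M⁻¹ ∑ j χ(j)`).
[cite: Washington1997, Thm. 4.2] -/
theorem valuation_generalizedBernoulli_one_le_one (ι : PadicAlgCl p ≃+* ℂ) (hpM : ¬ p ∣ M)
    (hχ : χ ≠ 1) : Valued.v (ι.symm (generalizedBernoulli 1 χ)) ≤ 1 := by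
  rw [generalizedBernoulli_one_eq χ hχ, map_div₀, map_div₀, valuation_symm_natCast_eq_one ι hpM,
    div_one, map_sum, ]
  refine Valuation.map_sum_le _ fun j _ ↦ ?_
  rw [map_mul, Valuation.map_mul]
  exact mul_le_one' (valuation_symm_natCast_le_one ι _) (valuation_symm_apply_le_one χ ι j)

/-- The normalised higher coefficients `σ^{χ̄}(n)` are `p`-integral. [folklore] -/
theorem valuation_symm_divisorSum_inv_le_one (ι : PadicAlgCl p ≃+* ℂ) (n : ℕ) :
    Valued.v (ι.symm (∑ d ∈ n.divisors, χ⁻¹ (d : ZMod M))) ≤ 1 := by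
  rw [map_sum]
  refine Valuation.map_sum_le _ fun d _ ↦ ?_
  exact valuation_symm_apply_le_one χ⁻¹ ι _

/-- **`p`-integrality of the normalised `q`-expansion of `G̃_χ(·,0)`** (`p ∤ 2M`; the constant
coefficient is `-B_{1,χ̄}/2`, the others `σ^{χ̄}(n)`). [cite: Miyake2006, Thm. 7.2.13] -/
theorem valuation_inv_heckeOneConst_mul_coeff_le_one (ι : PadicAlgCl p ≃+* ℂ) (hprim : χ.IsPrimitive)
    (hodd : χ.Odd) (hpM : ¬ p ∣ M) (hp2 : p ≠ 2) (n : ℕ) :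
    Valued.v (ι.symm ((heckeOneConst χ)⁻¹ * heckeOneCoeff χ n)) ≤ 1 := by
  have h2 : Valued.v (ι.symm (2 : ℂ)) = 1 := by
    have := valuation_symm_natCast_eq_one ι (n := 2)
      (fun h ↦ hp2 ((Nat.prime_dvd_prime_iff_eq Fact.out Nat.prime_two).mp h))
    exact_mod_cast this
  by_cases hn : n = 0
  · subst hn
    rw [inv_heckeOneConst_mul_heckeOneCoeff_zero χ hprim hodd, map_div₀, map_neg, map_div₀,
      Valuation.map_neg, h2, div_one]
    have hne : χ⁻¹ ≠ 1 := inv_ne_one.mpr (ne_one_of_odd χ hodd)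
    exact valuation_generalizedBernoulli_one_le_one χ⁻¹ ι hpM hne
  · rw [heckeOneCoeff_of_ne_zero χ hn, ← mul_assoc, inv_mul_cancel₀ (heckeOneConst_ne_zero χ hprim),
      one_mul]
    exact valuation_symm_divisorSum_inv_le_one χ ι n

/-- **The cusp unit is a `p`-adic unit** when `B_{1,χ}` is (`p ∤ 2M`, `χ` primitive).
[cite: Hecke1927, §2] -/
theorem valuation_heckeOneUnit_eq_one (ι : PadicAlgCl p ≃+* ℂ) (hprim : χ.IsPrimitive)
    (hpM : ¬ p ∣ M) (hp2 : p ≠ 2) (hB : Valued.v (ι.symm (generalizedBernoulli 1 χ)) = 1) :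
    Valued.v (ι.symm (heckeOneUnit χ)) = 1 := by
  have h2 : Valued.v (ι.symm (2 : ℂ)) = 1 := by
    have := valuation_symm_natCast_eq_one ι (n := 2)
      (fun h ↦ hp2 ((Nat.prime_dvd_prime_iff_eq Fact.out Nat.prime_two).mp h))
    exact_mod_cast this
  have hW := valuation_symm_gaussSum_eq_one ι χ hprim hpM
  rw [heckeOneUnit, map_div₀, map_neg, map_div₀, Valuation.map_neg, hB, map_mul, Valuation.map_mul,
    h2, hW, one_mul, div_one]

end Normalised

end Literature.NumberTheory.EllipticCurves.ModularForms
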